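import Summits.ValiantsHypothesis.ValiantsHypothesis.Theorems.BarrierLeverTransversalMinorLayoutsEightFaces

/-!
# Route BarrierLever — item `TransversalLayoutsRankLeEight` (stmt-ValiantsHypothesis-19933):
# eight-face complexes without vertices of degree two and three / two and four

Helper file (`--supports stmt-ValiantsHypothesis-19933`; cell valiant-natproofs, rung V4, 𝒟-side of
door (c); seat val-np-p1 gen 8).  Partner classifications for the locked cell `(4, 8)` (the full
side is the `4`-path with class sizes `2, 3, 5, 6`, or the `3`-star with class sizes `2, 4, 6`):

* `lowerFamily_eight_no_degree_two_three`: a lower family of eight sets with a member of size `≥ 2`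
  and no element of degree two or three is a SOLID TRIANGLE (a pair member `{a, b}` would put `a`
  and `b` in `≥ 4` members each, too many);
* `lowerFamily_eight_no_degree_two_four`: a lower family of eight sets with a member of size `≥ 2`
  and no element of degree two or four is the TRIANGLE GRAPH PLUS A POINT
  `∅, a, b, c, ab, ac, bc, d`.

WHAT THIS IS NOT: bookkeeping for a bounded-rank slice of TT; nothing on TT / item 19761 in
general, on crux stmt-ValiantsHypothesis-14610, or on `VP` versus `VNP`.
-/

-- layout Summits/ValiantsHypothesis/ValiantsHypothesis forces the duplicated namespace component
set_option linter.dupNamespace false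

open Matrix Finset

namespace Summit.ValiantsHypothesis.ValiantsHypothesis.Theorems.BarrierLever.FiniteCheck

open Summit.ValiantsHypothesis.ValiantsHypothesis.Theorems.BarrierLever.Compression

/-- In a graph-like lower family, the members containing `a` other than `{a}` are pairs `{a, c}`. -/
theorem mem_filter_pair {h : ℕ} (F : Finset (Finset (Fin h))) (hle2 : ∀ x ∈ F, x.card ≤ 2)
    (a : Fin h) (y : Finset (Fin h)) (hy : y ∈ F.filter fun x => a ∈ x) (hya : y ≠ {a}) :
    ∃ c : Fin h, c ≠ a ∧ y = {a, c} := by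
  classical
  rw [Finset.mem_filter] at hy
  obtain ⟨hyF, hay⟩ := hy
  have hy2 : y.card = 2 := by
    have := hle2 y hyF
    rcases Nat.lt_or_ge y.card 2 with hlt | hge
    · exfalso
      have hy1 : y.card ≤ 1 := by omega
      exact hya (Finset.eq_singleton_iff_unique_mem.mpr ⟨hay, fun e he =>
        Finset.card_le_one.mp hy1 e he a hay⟩)
    · omega
  obtain ⟨c, hc⟩ := Finset.card_eq_one.mp
    (show (y.erase a).card = 1 by rw [Finset.card_erase_of_mem hay, hy2])
  have hcy : c ∈ y.erase a := by rw [hc]; simp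
  obtain ⟨hca, _⟩ := Finset.mem_erase.mp hcy
  exact ⟨c, hca, by rw [← Finset.insert_erase hay, hc]⟩

/-- A lower family of exactly eight sets with a member of size `≥ 2` and no element lying in exactly
two or exactly three members is a SOLID TRIANGLE. -/
theorem lowerFamily_eight_no_degree_two_three {h : ℕ} (F : Finset (Finset (Fin h)))
    (hlow : ∀ x ∈ F, ∀ t, t ⊆ x → t ∈ F) (hF : F.card = 8) (hbig : ∃ x ∈ F, 2 ≤ x.card)
    (hdeg2 : ∀ c : Fin h, (F.filter fun x => c ∈ x).card ≠ 2)
    (hdeg3 : ∀ c : Fin h, (F.filter fun x => c ∈ x).card ≠ 3) :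
    ∃ a b c : Fin h, a ≠ b ∧ a ≠ c ∧ b ≠ c ∧ ∀ y ∈ F, y ⊆ {a, b, c} := by
  classical
  by_cases h3 : ∃ x ∈ F, 3 ≤ x.card
  · obtain ⟨x, hx, hx3⟩ := h3
    obtain ⟨S, hS3, hFS⟩ := eq_powerset_of_three_le_card F hlow (by omega) x hx hx3
    obtain ⟨a, b, c, hab, hac, hbc, rfl⟩ := Finset.card_eq_three.mp hS3
    exact ⟨a, b, c, hab, hac, hbc, fun y hy => by rw [hFS, Finset.mem_powerset] at hy; exact hy⟩
  exfalso
  push Not at h3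
  have hle2 : ∀ x ∈ F, x.card ≤ 2 := fun x hx => by have := h3 x hx; omega
  obtain ⟨x, hxF, hx2⟩ := hbig
  have hx2' : x.card = 2 := le_antisymm (hle2 x hxF) hx2
  obtain ⟨a, b, hab, rfl⟩ := Finset.card_eq_two.mp hx2'
  have haF : ({a} : Finset (Fin h)) ∈ F := hlow _ hxF _ (by simp)
  have hbF : ({b} : Finset (Fin h)) ∈ F := hlow _ hxF _ (by simp)
  -- the members through `a` and through `b`: at least four each
  set Fa := F.filter fun y => a ∈ y with hFa
  set Fb := F.filter fun y => b ∈ y with hFb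
  have hsub_a : ({{a}, {a, b}} : Finset (Finset (Fin h))) ⊆ Fa := by
    intro t ht
    simp only [Finset.mem_insert, Finset.mem_singleton] at ht
    rcases ht with rfl | rfl
    · exact Finset.mem_filter.mpr ⟨haF, by simp⟩
    · exact Finset.mem_filter.mpr ⟨hxF, by simp⟩
  have hsub_b : ({{b}, {a, b}} : Finset (Finset (Fin h))) ⊆ Fb := by
    intro t ht
    simp only [Finset.mem_insert, Finset.mem_singleton] at ht
    rcases ht with rfl | rfl
    · exact Finset.mem_filter.mpr ⟨hbF, by simp⟩
    · exact Finset.mem_filter.mpr ⟨hxF, by simp⟩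
  have h2a : ({{a}, {a, b}} : Finset (Finset (Fin h))).card = 2 := by
    rw [Finset.card_pair]
    intro e
    have : b ∈ ({a} : Finset (Fin h)) := by rw [e]; simp
    exact hab (Finset.mem_singleton.mp this).symm
  have h2b : ({{b}, {a, b}} : Finset (Finset (Fin h))).card = 2 := by
    rw [Finset.card_pair]
    intro e
    have : a ∈ ({b} : Finset (Fin h)) := by rw [e]; simp
    exact hab (Finset.mem_singleton.mp this)
  have hFa4 : 4 ≤ Fa.card := by
    have := Finset.card_le_card hsub_a
    rw [h2a] at this
    have h2 := hdeg2 a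
    have h3' := hdeg3 a
    rw [← hFa] at h2 h3'
    omega
  have hFb4 : 4 ≤ Fb.card := by
    have := Finset.card_le_card hsub_b
    rw [h2b] at this
    have h2 := hdeg2 b
    have h3' := hdeg3 b
    rw [← hFb] at h2 h3'
    omega
  -- Fa ∩ Fb ⊆ {{a, b}}
  have hinter : (Fa ∩ Fb).card ≤ 1 := by
    have : Fa ∩ Fb ⊆ {{a, b}} := by
      intro y hy
      rw [Finset.mem_inter, hFa, hFb, Finset.mem_filter, Finset.mem_filter] at hy
      obtain ⟨⟨hyF, hay⟩, -, hby⟩ := hy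
      rw [Finset.mem_singleton]
      symm
      apply Finset.eq_of_subset_of_card_le
      · intro e he
        simp only [Finset.mem_insert, Finset.mem_singleton] at he
        rcases he with rfl | rfl
        · exact hay
        · exact hby
      · rw [Finset.card_pair hab]; exact hle2 y hyF
    exact (Finset.card_le_card this).trans (by simp)
  have hunion : 7 ≤ (Fa ∪ Fb).card := by
    have := Finset.card_union_add_card_inter Fa Fb
    omega
  -- a member `{a, c}` with `c ∉ {a, b}`, hence `{c} ∈ F` outside `Fa ∪ Fb`, and `∅` too
  obtain ⟨y, hy, hyn⟩ : ∃ y ∈ Fa, y ∉ ({{a}, {a, b}} : Finset (Finset (Fin h))) := by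
    by_contra hno
    push Not at hno
    have := Finset.card_le_card (show Fa ⊆ {{a}, {a, b}} from hno)
    rw [h2a] at this
    omega
  simp only [Finset.mem_insert, Finset.mem_singleton, not_or] at hyn
  obtain ⟨c, hca, hyc⟩ := mem_filter_pair F hle2 a y hy hyn.1
  have hcb : c ≠ b := fun e => hyn.2 (by rw [hyc, e])
  have hyF : y ∈ F := (Finset.mem_filter.mp hy).1
  have hcF : ({c} : Finset (Fin h)) ∈ F := hlow y hyF _ (by rw [hyc]; simp)
  have hemptyF : (∅ : Finset (Fin h)) ∈ F := hlow y hyF _ (Finset.empty_subset _)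
  have hout : ({∅, {c}} : Finset (Finset (Fin h))) ⊆ F \ (Fa ∪ Fb) := by
    intro t ht
    simp only [Finset.mem_insert, Finset.mem_singleton] at ht
    rw [Finset.mem_sdiff, Finset.mem_union, hFa, hFb, Finset.mem_filter, Finset.mem_filter]
    rcases ht with rfl | rfl
    · exact ⟨hemptyF, by simp⟩
    · refine ⟨hcF, ?_⟩
      rintro (⟨-, h1⟩ | ⟨-, h1⟩)
      · exact hca (Finset.mem_singleton.mp h1).symm
      · exact hcb (Finset.mem_singleton.mp h1).symm
  have h2out : ({∅, {c}} : Finset (Finset (Fin h))).card = 2 := by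
    rw [Finset.card_pair]; exact (Finset.singleton_ne_empty c).symm
  have hFsub : Fa ∪ Fb ⊆ F := by
    intro t ht
    rw [Finset.mem_union, hFa, hFb, Finset.mem_filter, Finset.mem_filter] at ht
    rcases ht with h1 | h1
    · exact h1.1
    · exact h1.1
  have := Finset.card_le_card hout
  rw [h2out, Finset.card_sdiff_of_subset hFsub, hF] at this
  omega

/-- In a lower family of eight sets of size `≤ 2` with no element of degree two or four, a vertex
`v` of a pair member `{v, v'}` lies in exactly three members: `{v}`, `{v, v'}` and one more pair
`{v, c}`. -/
theorem third_pair_of_no_degree_two_four {h : ℕ} (F : Finset (Finset (Fin h)))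
    (hlow : ∀ x ∈ F, ∀ t, t ⊆ x → t ∈ F) (hF : F.card = 8) (hle2 : ∀ x ∈ F, x.card ≤ 2)
    (hdeg2 : ∀ c : Fin h, (F.filter fun x => c ∈ x).card ≠ 2)
    (hdeg4 : ∀ c : Fin h, (F.filter fun x => c ∈ x).card ≠ 4) (v v' : Fin h) (hvv' : v ≠ v')
    (hvF : ({v, v'} : Finset (Fin h)) ∈ F) :
    ∃ c : Fin h, c ≠ v ∧ c ≠ v' ∧ ({v, c} : Finset (Fin h)) ∈ F ∧
      ∀ y ∈ F, v ∈ y → y = {v} ∨ y = {v, v'} ∨ y = {v, c} := by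
  classical
  have hvF1 : ({v} : Finset (Fin h)) ∈ F := hlow _ hvF _ (by simp)
  set Fv := F.filter fun y => v ∈ y with hFv
  have hsub : ({{v}, {v, v'}} : Finset (Finset (Fin h))) ⊆ Fv := by
    intro t ht
    simp only [Finset.mem_insert, Finset.mem_singleton] at ht
    rcases ht with rfl | rfl
    · exact Finset.mem_filter.mpr ⟨hvF1, by simp⟩
    · exact Finset.mem_filter.mpr ⟨hvF, by simp⟩
  have h2 : ({{v}, {v, v'}} : Finset (Finset (Fin h))).card = 2 := by
    rw [Finset.card_pair]
    intro e
    have : v' ∈ ({v} : Finset (Fin h)) := by rw [e]; simp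
    exact hvv' (Finset.mem_singleton.mp this).symm
  have hge3 : 3 ≤ Fv.card := by
    have := Finset.card_le_card hsub
    rw [h2] at this
    have := hdeg2 v
    rw [← hFv] at this
    omega
  -- a third member {v, c}
  obtain ⟨y, hy, hyn⟩ : ∃ y ∈ Fv, y ∉ ({{v}, {v, v'}} : Finset (Finset (Fin h))) := by
    by_contra hno
    push Not at hno
    have := Finset.card_le_card (show Fv ⊆ {{v}, {v, v'}} from hno)
    rw [h2] at this
    omega
  simp only [Finset.mem_insert, Finset.mem_singleton, not_or] at hyn
  obtain ⟨c, hcv, hyc⟩ := mem_filter_pair F hle2 v y hy hyn.1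
  have hcv' : c ≠ v' := fun e => hyn.2 (by rw [hyc, e])
  have hyF : y ∈ F := (Finset.mem_filter.mp hy).1
  refine ⟨c, hcv, hcv', hyc ▸ hyF, ?_⟩
  -- no fourth member through v: else degree ≥ 5 gives ≥ 4 pairs and too many members
  intro z hzF hvz
  by_contra hno
  simp only [not_or] at hno
  obtain ⟨d, hdv, hzd⟩ := mem_filter_pair F hle2 v z (Finset.mem_filter.mpr ⟨hzF, hvz⟩) hno.1
  have hdv' : d ≠ v' := fun e => hno.2.1 (by rw [hzd, e])
  have hdc : d ≠ c := fun e => hno.2.2 (by rw [hzd, e])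
  -- Fv ⊇ {v}, {v,v'}, {v,c}, {v,d}: degree 4 unless a fifth, so ≥ 5: a further {v, e}
  have hsub4 : ({{v}, {v, v'}, {v, c}, {v, d}} : Finset (Finset (Fin h))) ⊆ Fv := by
    intro t ht
    simp only [Finset.mem_insert, Finset.mem_singleton] at ht
    rcases ht with rfl | rfl | rfl | rfl
    · exact Finset.mem_filter.mpr ⟨hvF1, by simp⟩
    · exact Finset.mem_filter.mpr ⟨hvF, by simp⟩
    · exact Finset.mem_filter.mpr ⟨hyc ▸ hyF, by simp⟩
    · exact Finset.mem_filter.mpr ⟨hzd ▸ hzF, by simp⟩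
  have hpair_ne : ∀ p q : Fin h, p ≠ v → ({v, p} : Finset (Fin h)) = {v, q} → p = q := by
    intro p q hpv e
    have : p ∈ ({v, q} : Finset (Fin h)) := by rw [← e]; simp
    simp only [Finset.mem_insert, Finset.mem_singleton] at this
    rcases this with h1 | h1
    · exact absurd h1 hpv
    · exact h1
  have h4 : ({{v}, {v, v'}, {v, c}, {v, d}} : Finset (Finset (Fin h))).card = 4 := by
    have n3 : ({v, c} : Finset (Fin h)) ∉ ({{v, d}} : Finset (Finset (Fin h))) := by
      rw [Finset.mem_singleton]; exact fun e => hdc (hpair_ne c d hcv e).symm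
    have n2 : ({v, v'} : Finset (Fin h)) ∉ ({{v, c}, {v, d}} : Finset (Finset (Fin h))) := by
      simp only [Finset.mem_insert, Finset.mem_singleton, not_or]
      exact ⟨fun e => hcv' (hpair_ne v' c hvv'.symm e).symm,
        fun e => hdv' (hpair_ne v' d hvv'.symm e).symm⟩
    have n1 : ({v} : Finset (Fin h)) ∉ ({{v, v'}, {v, c}, {v, d}} : Finset (Finset (Fin h))) := by
      simp only [Finset.mem_insert, Finset.mem_singleton, not_or]
      refine ⟨fun e => ?_, fun e => ?_, fun e => ?_⟩
      · have : v' ∈ ({v} : Finset (Fin h)) := by rw [e]; simp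
        exact hvv' (Finset.mem_singleton.mp this).symm
      · have : c ∈ ({v} : Finset (Fin h)) := by rw [e]; simp
        exact hcv (Finset.mem_singleton.mp this)
      · have : d ∈ ({v} : Finset (Fin h)) := by rw [e]; simp
        exact hdv (Finset.mem_singleton.mp this)
    rw [Finset.card_insert_of_notMem n1, Finset.card_insert_of_notMem n2,
      Finset.card_insert_of_notMem n3, Finset.card_singleton]
  have hge5 : 5 ≤ Fv.card := by
    have := Finset.card_le_card hsub4
    rw [h4] at this
    have := hdeg4 v
    rw [← hFv] at this
    omega
  obtain ⟨z', hz', hz'n⟩ : ∃ z' ∈ Fv,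
      z' ∉ ({{v}, {v, v'}, {v, c}, {v, d}} : Finset (Finset (Fin h))) := by
    by_contra hno'
    push Not at hno'
    have := Finset.card_le_card (show Fv ⊆ {{v}, {v, v'}, {v, c}, {v, d}} from hno')
    rw [h4] at this
    omega
  simp only [Finset.mem_insert, Finset.mem_singleton, not_or] at hz'n
  obtain ⟨e, hev, hz'e⟩ := mem_filter_pair F hle2 v z' hz' hz'n.1
  have hev' : e ≠ v' := fun e' => hz'n.2.1 (by rw [hz'e, e'])
  have hec : e ≠ c := fun e' => hz'n.2.2.1 (by rw [hz'e, e'])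
  have hed : e ≠ d := fun e' => hz'n.2.2.2 (by rw [hz'e, e'])
  have hz'F : z' ∈ F := (Finset.mem_filter.mp hz').1
  -- ten distinct members: ∅, v, v', c, d, e, vv', vc, vd, ve
  have hten : ({∅, {v}, {v'}, {c}, {d}, {e}, {v, v'}, {v, c}, {v, d}, {v, e}} :
      Finset (Finset (Fin h))) ⊆ F := by
    intro t ht
    simp only [Finset.mem_insert, Finset.mem_singleton] at ht
    rcases ht with rfl | rfl | rfl | rfl | rfl | rfl | rfl | rfl | rfl | rfl
    · exact hlow _ hvF _ (Finset.empty_subset _)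
    · exact hvF1
    · exact hlow _ hvF _ (by simp)
    · exact hlow _ (hyc ▸ hyF) _ (by simp)
    · exact hlow _ (hzd ▸ hzF) _ (by simp)
    · exact hlow _ (hz'e ▸ hz'F) _ (by simp)
    · exact hvF
    · exact hyc ▸ hyF
    · exact hzd ▸ hzF
    · exact hz'e ▸ hz'F
  have hcard10 : 8 < ({∅, {v}, {v'}, {c}, {d}, {e}, {v, v'}, {v, c}, {v, d}, {v, e}} :
      Finset (Finset (Fin h))).card := by
    -- the singletons {v'}, {c}, {d}, {e} and ∅ are five members of size ≤ 1, the other five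
    -- have v; count via the filter by membership of v
    have hA : ({∅, {v'}, {c}, {d}, {e}} : Finset (Finset (Fin h))) ⊆
        ({∅, {v}, {v'}, {c}, {d}, {e}, {v, v'}, {v, c}, {v, d}, {v, e}} :
          Finset (Finset (Fin h))).filter fun t => v ∉ t := by
      intro t ht
      simp only [Finset.mem_insert, Finset.mem_singleton] at ht
      rw [Finset.mem_filter]
      rcases ht with rfl | rfl | rfl | rfl | rfl
      · exact ⟨by simp, by simp⟩
      · exact ⟨by simp, by simp [Finset.mem_singleton]; exact fun e' => hvv' e'⟩
      · exact ⟨by simp, by rw [Finset.mem_singleton]; exact fun e' => hcv e'.symm⟩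
      · exact ⟨by simp, by rw [Finset.mem_singleton]; exact fun e' => hdv e'.symm⟩
      · exact ⟨by simp, by rw [Finset.mem_singleton]; exact fun e' => hev e'.symm⟩
    have hB : ({{v}, {v, v'}, {v, c}, {v, d}, {v, e}} : Finset (Finset (Fin h))) ⊆
        ({∅, {v}, {v'}, {c}, {d}, {e}, {v, v'}, {v, c}, {v, d}, {v, e}} :
          Finset (Finset (Fin h))).filter fun t => v ∈ t := by
      intro t ht
      simp only [Finset.mem_insert, Finset.mem_singleton] at ht
      rw [Finset.mem_filter]
      rcases ht with rfl | rfl | rfl | rfl | rfl <;> exact ⟨by simp, by simp⟩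
    have hA5 : ({∅, {v'}, {c}, {d}, {e}} : Finset (Finset (Fin h))).card = 5 := by
      have s1 : ∀ p q : Fin h, p ≠ q → ({p} : Finset (Fin h)) ≠ {q} :=
        fun p q hpq e' => hpq (Finset.singleton_injective e')
      rw [Finset.card_insert_of_notMem, Finset.card_insert_of_notMem,
        Finset.card_insert_of_notMem, Finset.card_pair (s1 d e hed.symm)]
      · simp only [Finset.mem_insert, Finset.mem_singleton, not_or]
        exact ⟨s1 c d hdc.symm, s1 c e hec.symm⟩
      · simp only [Finset.mem_insert, Finset.mem_singleton, not_or]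
        exact ⟨s1 v' c hcv'.symm, s1 v' d hdv'.symm, s1 v' e hev'.symm⟩
      · simp only [Finset.mem_insert, Finset.mem_singleton, not_or]
        exact ⟨(Finset.singleton_ne_empty _).symm, (Finset.singleton_ne_empty _).symm,
          (Finset.singleton_ne_empty _).symm, (Finset.singleton_ne_empty _).symm⟩
    have hB5 : ({{v}, {v, v'}, {v, c}, {v, d}, {v, e}} : Finset (Finset (Fin h))).card = 5 := by
      have n4 : ({v, d} : Finset (Fin h)) ∉ ({{v, e}} : Finset (Finset (Fin h))) := by
        rw [Finset.mem_singleton]; exact fun e' => hed (hpair_ne d e hdv e').symm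
      have n3 : ({v, c} : Finset (Fin h)) ∉ ({{v, d}, {v, e}} : Finset (Finset (Fin h))) := by
        simp only [Finset.mem_insert, Finset.mem_singleton, not_or]
        exact ⟨fun e' => hdc (hpair_ne c d hcv e').symm, fun e' => hec (hpair_ne c e hcv e').symm⟩
      have n2 : ({v, v'} : Finset (Fin h)) ∉ ({{v, c}, {v, d}, {v, e}} : Finset (Finset (Fin h))) := by
        simp only [Finset.mem_insert, Finset.mem_singleton, not_or]
        exact ⟨fun e' => hcv' (hpair_ne v' c hvv'.symm e').symm,
          fun e' => hdv' (hpair_ne v' d hvv'.symm e').symm,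
          fun e' => hev' (hpair_ne v' e hvv'.symm e').symm⟩
      have n1 : ({v} : Finset (Fin h)) ∉
          ({{v, v'}, {v, c}, {v, d}, {v, e}} : Finset (Finset (Fin h))) := by
        simp only [Finset.mem_insert, Finset.mem_singleton, not_or]
        refine ⟨fun e' => ?_, fun e' => ?_, fun e' => ?_, fun e' => ?_⟩
        · have : v' ∈ ({v} : Finset (Fin h)) := by rw [e']; simp
          exact hvv' (Finset.mem_singleton.mp this).symm
        · have : c ∈ ({v} : Finset (Fin h)) := by rw [e']; simp
          exact hcv (Finset.mem_singleton.mp this)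
        · have : d ∈ ({v} : Finset (Fin h)) := by rw [e']; simp
          exact hdv (Finset.mem_singleton.mp this)
        · have : e ∈ ({v} : Finset (Fin h)) := by rw [e']; simp
          exact hev (Finset.mem_singleton.mp this)
      rw [Finset.card_insert_of_notMem n1, Finset.card_insert_of_notMem n2,
        Finset.card_insert_of_notMem n3, Finset.card_insert_of_notMem n4, Finset.card_singleton]
    have hsum := Finset.card_filter_add_card_filter_not
      (s := ({∅, {v}, {v'}, {c}, {d}, {e}, {v, v'}, {v, c}, {v, d}, {v, e}} :
        Finset (Finset (Fin h)))) (fun t => v ∈ t)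
    have h1 := Finset.card_le_card hA
    have h2 := Finset.card_le_card hB
    rw [hA5] at h1
    rw [hB5] at h2
    omega
  have := Finset.card_le_card hten
  rw [hF] at this
  omega

end Summit.ValiantsHypothesis.ValiantsHypothesis.Theorems.BarrierLever.FiniteCheck
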